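import Summits.BirchSwinnertonDyer.BirchSwinnertonDyer.Theses.SignedBaseChange
import HarnessLib

/-!
# Sketch — First lemma of the crux idea card `endolift` (bsd-idea-14 g6, lens = complete)

Crux item stmt-BirchSwinnertonDyer-20728 =
`Summit.BirchSwinnertonDyer.BirchSwinnertonDyer.Theses.SignedBaseChange.TwoVariableEulerSystemDivisibility`
(line of record `Cruxes/TwoVariableEulerSystemDivisibility/Lines/ratlift.lean`, hardest stub F1 =
`stub_ratEulerSystemSS`).

`PAdicLineRatDivisibilitySS` below is the FIRST RUNG of the endoscopic-`GU(2,1)` line: the RATIONAL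
Greenberg divisibility `p^a · G ∈ ch_{Λ_K}(X_Gr) · 𝒪⟦T₁,T₂⟧` RESTRICTED TO THE `𝔭`-ADIC LINE of `Γ_K`
(the `ℤ_p`-line of characters trivial on the inertia group at `v̄`), written in coordinates in which
that line is the diagonal `T₁ = T₂` (hypothesis `hbal`: the generator pair is inertia-balanced at `v̄`,
typed with Mathlib's `ValuationSubring.inertiaSubgroup` of a valuation ring `A ⊂ K̄` over `v̄`).
It is implied by F1 (apply the quotient map modulo `(T₁ − T₂)`), hence strictly on the line's path and
NOT a transfer; it is what the integral (`𝔭`-ordinary, via the auxiliary character) direction of the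
endoscopic Euler system would give before any `♯/♭` work in the `𝔭̄`-direction.
Nothing is asserted (`def … : Prop`). BSD is not proved by this seat.
-/

set_option autoImplicit false

namespace Summit.BirchSwinnertonDyer.BirchSwinnertonDyer.Cruxes.IdeaSketches

open Summit.BirchSwinnertonDyer.BirchSwinnertonDyer.Theses.SignedBaseChange
open Literature.NumberTheory.EllipticCurves Literature.NumberTheory.EllipticCurves.Module
open Literature.NumberTheory.EllipticCurves.ModularForms

/-- First lemma of card `endolift`: the rational two-variable Greenberg divisibility of the crux,
restricted to the `𝔭`-adic line (diagonal in inertia-balanced coordinates), at a good supersingular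
prime. Binders = those of `stub_ratEulerSystemSS` + a valuation ring `A` of `K̄` over `v̄` + the
balancing hypothesis `hbal`; conclusion = the image of `p^a · G` modulo `(T₁ − T₂)` lies in the image of
the extended characteristic ideal. -/
def PAdicLineRatDivisibilitySS : Prop :=
  SignedTwoVariableInputs → Literature.NumberTheory.EllipticCurves.ModularForms.nonempty_modularParametrizationData → ∀ (W : WeierstrassCurve ℚ) [W.IsElliptic] [W.IsGloballyMinimal] (p : ℕ) [Fact p.Prime], 5 ≤ p → W.HasGoodReductionAtPrime p → W.frobeniusTrace p = 0 → Literature.NumberTheory.EllipticCurves.Rank1Residual.Surj W p → ∀ (K : Type) [Field K] [NumberField K] (ι : PadicAlgCl p ≃+* ℂ) (v vbar : IsDedekindDomain.HeightOneSpectrum (NumberField.RingOfIntegers K)) (κ₁ κ₂ : Literature.NumberTheory.EllipticCurves.ZpExtension K p) (γ₁ γ₂ : Field.absoluteGaloisGroup K) [Fact (Literature.NumberTheory.EllipticCurves.ZpExtension.IsTopGeneratorPair κ₁ κ₂ γ₁ γ₂)] [NeZero (NumberField.discr K).natAbs] (N : ℕ) [NeZero N] (f : CuspForm (CongruenceSubgroup.Gamma0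 N) 2), Literature.NumberTheory.EllipticCurves.ModularForms.IsNewformOf W f → (N : ℤ) = W.conductorNorm ℤ → Literature.NumberTheory.EllipticCurves.IsImaginaryQuadratic K → ((Ideal.span {(p : ℤ)}).primesOver (NumberField.RingOfIntegers K)).ncard = 2 → ((p : ℕ) : NumberField.RingOfIntegers K) ∈ v.asIdeal → ((p : ℕ) : NumberField.RingOfIntegers K) ∈ vbar.asIdeal → vbar ≠ v → (∀ (w : NumberField.InfinitePlace K) (k : NumberField.RingOfIntegers K), k ∈ v.asIdeal ↔ ‖ι.symm (w.embedding (k : K))‖ < 1) → IsCoprime (N : ℤ) (NumberField.discr K) → (∀ ℓ : ℕ, ℓ.Prime → ℓ ∣ N → ((Ideal.span {(ℓ : ℤ)}).primesOver (NumberField.RingOfIntegers K)).ncard = 2) → Odd (NumberField.discr K) → NumberField.discr K ≠ -3 → κ₁.IsCyclotomic → κ₂.IsAnticyclotomic → ∀ (Ω δ : ℂ) (Ωp : (Literature.NumberTheory.EllipticCurves.unrIntegers p)ˣ) (LK G : PowerSeries (PowerSeries (PadicComplexInt p))), Ω ≠ 0 → (δ ^ 2 = (NumberField.discr K : ℂ)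 ∨ δ ^ 2 = -(NumberField.discr K : ℂ)) → Literature.NumberTheory.EllipticCurves.IsKatzMeasure₂ ι v vbar ∅ κ₁ κ₂ γ₁⁻¹ γ₂⁻¹ 1 Ω δ ((Ωp : Literature.NumberTheory.EllipticCurves.unrIntegers p) : PadicComplex p) LK → Literature.NumberTheory.EllipticCurves.IsGreenbergLFunctionAnyRoot₂ ι v vbar κ₁ κ₂ γ₁⁻¹ γ₂⁻¹ f (NumberField.discr K).natAbs (NumberField.classNumber K) LK G → ∀ J : ℤ_[p] →+* PadicComplexInt p, (∀ x : ℤ_[p], ((J x : PadicComplexInt p) : PadicComplex p) = ((x : ℚ_[p]) : PadicComplex p)) →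
    -- a valuation ring `A` of `K̄ = AlgebraicClosure K` lying over `v̄` …
    ∀ (A : ValuationSubring (AlgebraicClosure K)),
      (∀ k : NumberField.RingOfIntegers K,
        k ∈ vbar.asIdeal ↔ A.valuation (algebraMap K (AlgebraicClosure K) (k : K)) < 1) →
    -- … in coordinates that are INERTIA-BALANCED at `v̄`: the inertia group `I_{v̄} ⊂ Γ_K` is killed by
    -- `κ₁ + κ₂`, so the `𝔭`-adic line (characters trivial on `I_{v̄}`) is the diagonal `T₁ = T₂`
      (∀ σ : A.decompositionSubgroup K, σ ∈ A.inertiaSubgroup K →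
        Multiplicative.toAdd (κ₁ (σ : AlgebraicClosure K ≃ₐ[K] AlgebraicClosure K)) +
          Multiplicative.toAdd (κ₂ (σ : AlgebraicClosure K ≃ₐ[K] AlgebraicClosure K)) = 0) →
      ∃ a : ℕ,
        Ideal.Quotient.mk
            (Ideal.span {(PowerSeries.X : PowerSeries (PowerSeries (PadicComplexInt p))) -
              PowerSeries.C (PowerSeries.X : PowerSeries (PadicComplexInt p))})
            (((p : ℕ) : PowerSeries (PowerSeries (PadicComplexInt p))) ^ a * G) ∈
          ((WeierstrassCurve.XGr₂.charIdeal (W.baseChange K) p κ₁ κ₂ vbar γ₁ γ₂).map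
              (Literature.NumberTheory.EllipticCurves.IwasawaAlgebra₂.toUnr₂ p J)).map
            (Ideal.Quotient.mk
              (Ideal.span {(PowerSeries.X : PowerSeries (PowerSeries (PadicComplexInt p))) -
                PowerSeries.C (PowerSeries.X : PowerSeries (PadicComplexInt p))}))

end Summit.BirchSwinnertonDyer.BirchSwinnertonDyer.Cruxes.IdeaSketches
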